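import Summits.NavierStokesRegularity.NavierStokesRegularity.Theses.PerpetualPump
import Summits.NavierStokesRegularity.NavierStokesRegularity.Theorems.AveragedTypeIBlowup.Negative.NSReduction
import Summits.NavierStokesRegularity.NavierStokesRegularity.Theorems.RungReynoldsOne.Negative.WithoutLerayHopfFalse
import Summits.NavierStokesRegularity.NavierStokesRegularity.Theorems.TypeIConcentration.Negative.LoadBearing
import Literature.Analysis.FluidPDE.NSQuasipotential

/-!
# Disproof work file — crux `PerpetualPump.EulerTypeIGlue` (stmt-NavierStokesRegularity-1838), findings

Standing adversary (cdisprove), cycle 1, 2026-08-16. Everything below is kernel-checked (rc 0, no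
`sorry`); prose lives only in docstrings. The crux (route `PerpetualPump`, rank 9, glue/support,
grounded provable-L) is

  `EulerTypeIGlue := Thesis → NoTypeIClay`,

`Thesis` = abstract Type-I exclusion over Tao's averaging class (stmt-1832, the route TARGET, Tao's
open footnote question arXiv:1402.0290 p. 8), `NoTypeIClay` = "no Type-I blow-up for finite-energy
classical Navier–Stokes solutions from rapidly decaying data" (the consequent, spelled out in
`NoTypeIClay` below; shape of `TypeILiouville`'s stmt-0058).

## Findings

1. **NO KILL, and none is possible short of two open problems at once** (§1). The crux is an
   implication; `¬ EulerTypeIGlue ↔ Thesis ∧ ¬ NoTypeIClay` (`not_eulerTypeIGlue_iff`). A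
   refutation must therefore (i) PROVE `Thesis` — which the route itself bets is FALSE
   (cruxes `CircuitPump`/`PumpTransfer`/`AveragedTypeIBlowup` are its negative programme; if the
   bet is right the crux holds VACUOUSLY: `eulerTypeIGlue_of_not_thesis`,
   `eulerTypeIGlue_of_averagedTypeIBlowup`) and which contains forward Type-I exclusion for the true
   Navier–Stokes equations in Tao's `H¹⁰_df`-mild class (landed
   `AveragedTypeIBlowup.Negative.nsTypeI_extends_of_not_averagedTypeIBlowup`), AND (ii) produce a
   finite-energy classical NS solution from a Schwartz-class datum blowing up at the Type-I rate
   (`typeIBlowup_witness_of_not_eulerTypeIGlue`) — a negative answer to Clay (A). No interface,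
   no finite model, no junk regime is available: the consequent quantifies over honest fields on
   `ℝ³`, its hypotheses are satisfiable (rest state, `noTypeIClay_hypotheses_zero`) and met there
   (`noTypeIClay_conclusion_zero`), so it is neither vacuous nor trivially false.
2. **What the line actually proves is stronger and still unkillable**: the lead's composition
   `EulerTypeIGlue_of` (Lines/Sketch.lean) uses `Thesis` only at the Euler datum
   (`AveragingDatum.euler`), i.e. it proves `ThesisEuler → NoTypeIClay`
   (`eulerTypeIGlue_of_thesisEuler_imp`); `ThesisEuler` is itself NS Type-I exclusion (mild form),
   so this stronger glue is a solution-concept dictionary between two formulations of ONE open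
   statement — true "by bookkeeping", false only by a concept mismatch. The seven stubs were audited
   on paper for mismatches (§5): none found; two of them (`stub_backEnd`, `stub_memH10`) are already
   landed theorems.
3. **LOAD-BEARING (the one droppable hypothesis that bites): `IsLerayHopfOn`** (§3). With the
   Leray–Hopf (finite-energy) hypothesis deleted the consequent is FALSE outright
   (`noTypeIClay_false_without_lerayHopf`): the parasitic pressure-driven drift
   `u = ((1−t)^{-1/2} − 1)e₀`, `p = −½(1−t)^{-3/2} x₀` of Koch–Nadirashvili–Seregin–Šverák
   (Acta Math. 203 (2009) §1 p. 3) is classical on `[0,1) × ℝ³` for EVERY viscosity, starts from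
   the Schwartz datum `0` (so `HasRapidSpatialDecay` survives the mutation), is Type-I with constant
   `1` at `T = 1` (`isTypeIBlowup_driftI`), and has no classical continuation (it is unbounded at
   `t ↑ 1`). Hence the glue with `IsLerayHopfOn` dropped is EQUIVALENT TO `¬ Thesis`
   (`eulerTypeIGlueWithoutLerayHopf_iff_not_thesis`): the only thing standing between the crux and
   the negation of the route target is finite energy — in the line it is spent exactly once, in
   `stub_backEnd` (RRS Thm 8.17 needs `IsLerayHopfOn`) and in the `L²`-class `U t = [(u t)^ℂ]`
   (the drift's slices are not in `L²`: `not_memLp_driftI`). Landed as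
   `Theorems/EulerTypeIGlue/Negative/WithoutLerayHopfFalse.lean` (this cycle).
4. **NOT load-bearing / undecidable mutations** (§2, §4). `0 < T` is decoration
   (`hasSmoothExtensionPast_of_nonpos`: for `T ≤ 0` the conclusion holds for every field).
   Dropping `HasRapidSpatialDecay (u 0)` (keeping Leray–Hopf), `0 < ν`, `IsTypeIBlowup`, or
   `Thesis` each yields a statement whose negation is an open blow-up problem (finite-energy NS
   Type-I blow-up from an `L²`/smooth datum; smooth Euler blow-up on `ℝ³`; Clay (A) itself —
   `noTypeIClay_of_noBlowup`; KNSS/Seregin–Šverák-tier Type-I exclusion, known only under axial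
   symmetry, `Literature.Barriers.NavierStokesRegularity.AxisymmetricTypeIExclusion`) — so no
   `_false_without_` theorem exists for them, and none of them can be shown necessary either.
   Information for the prover: `HasRapidSpatialDecay` enters the line only through `H¹⁰`
   persistence down to `t = 0` (`stub_memH10`, `stub_continuity`); the back end
   `hasSmoothExtensionPast_of_bounded` does not use it.
5. **Line `Sketch` — stub audit (paper, this cycle; no stub found false, joint sufficiency is the
   lead's kernel-checked `EulerTypeIGlue_of`).** Junk regimes checked per stub:
   * `stub_cubic`: all four integrals converge under the stated hypotheses (`f ∈ H¹⁰ ⇒ f̂, |ξ|f̂ ∈ L¹`;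
     `ψ, Dψ ∈ L¹ ⇒ ψ̂` bounded, `(∂ⱼψ)^ = 2πiξⱼψ̂` since `C¹ ∩ W^{1,1}`); the identity follows on the
     Fourier side from `ξ·f̂(ξ) = 0` a.e. and the `ξ₁ ↔ ξ₂` symmetry of `Λ` — no integration by parts,
     so NO decay of `ψ` at infinity is needed and `ψ` need NOT be divergence free (the Fourier form
     `eulerForm` carries no Leray projection in the third slot). Sign/`2π`: with Tao's `𝓕`
     normalisation `⟨(u·∇)v, w⟩ = 2πi ∫∫ (û(ξ₁)·ξ₂)(v̂(ξ₂)·ŵ(ξ₃))`, consistent with `−πi Λ` and with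
     the x-side `∫⟪f,(f·∇)ψ⟫ = −⟨(f·∇)f, ψ⟩` (kit j015106 of the ideator agrees).
   * `stub_identityTests`: pointwise-in-`s` equality of the x-side and Tao-side Duhamel integrands
     (via `hcubic` at `ψ = e^{ν(t−s)Δ}φ ∈ C¹ ∩ W^{1,1}`), so the two interval integrals agree WITHOUT
     any integrability — Bochner junk, if any, is the same on both sides.
   * `stub_testToH10`: no sign hypothesis on `ν`; for `ν ≤ 0` the tree's `heat` is the identity
     (`heat_of_nonpos` below), and the density argument (`|B(a,a,w)| ≤ C‖a‖²_{H¹⁰}‖w‖_{L²}`,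
     dominated convergence in `s` using `ContinuousInH10On` on the compact `[0,t]`) is insensitive
     to it; `T ≤ 0` is vacuous. TRUE as stated.
   * `stub_continuity`: needs `sup_{[0,T₁]} ‖u‖_{H²⁰} < ∞` down to `t = 0` — supplied by
     `tao2011_hasBoundedSobolevNormsOn` on the CLOSED slab `[0,T₁]` (datum Schwartz); interpolation
     `‖g‖²_{H¹⁰} ≤ ‖g‖_{L²}‖g‖_{H²⁰}` is Cauchy–Schwarz on the Fourier side. TRUE.
   * `stub_normalise`: scaling checked by hand — `W(s) = ν⁻¹U(s/ν)` solves the unit-viscosity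
     Euler-datum equation iff the prefactor is `ν⁻¹` (it is), datum `ν⁻¹u₀`, rate
     `ν^{-1/2}M/√(νT−s)`; `integral_smul`/`integral_comp_div` are unconditional, so Bochner junk is
     scale-covariant; `M < 0` forces `U = 0` a.e. on both sides consistently. TRUE.
   * `stub_backEnd`, `stub_memH10`: LANDED (Theorems/PerpetualPumpEulerTypeIGlue{BackEnd,MemH10}).
   Nothing to post as `stub-false`/`stub-misstated`.

## What a disproof would have to look like (for the record)

Only a CONCEPT MISMATCH between `IsClassicalNSSolutionOn ∧ IsLerayHopfOn ∧ HasRapidSpatialDecay`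
and Tao's `IsMildSolutionFor eulerForm` could make `ThesisEuler → NoTypeIClay` false while both
sides are "morally" the same open statement. The places such a mismatch could hide were checked:
(i) `IsMildSolutionFor` pins `u 0` only through pairings against `H¹⁰_df` — enough, since
`u 0 − u₀` is real, divergence free and `L²`-orthogonal to a dense class; (ii) the extension
`v` on `[0,T')` is only required to AGREE with the rescaled curve on `[0,νT)`, and `H¹⁰`-continuity
at `νT` is all the back end uses (no uniqueness of mild solutions needed); (iii) `heat τ = id` for
`τ < 0` and `dil 0 = id` are never reached (`ν > 0`, `0 ≤ s ≤ t`); (iv) `IsLerayHopfOn T` constrains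
the junk slice `u T` (`memLp` on `Icc 0 T`, weak continuity on `Ioc 0 T`) — this only SHRINKS the
hypothesis class of `NoTypeIClay`, harmless for an implication used positively.
-/

noncomputable section

set_option linter.dupNamespace false

namespace Summit.NavierStokesRegularity.NavierStokesRegularity.Cruxes.EulerTypeIGlue.Disproof

open Set Filter Topology MeasureTheory Function
open scoped ENNReal
open Literature.Analysis.FluidPDE Literature.Analysis.FluidPDE.Tao2016
open Literature.Analysis.FluidPDE.Tao2016.AveragingDatum
open Summit.NavierStokesRegularity.NavierStokesRegularity.Theses.PerpetualPump
open Summit.NavierStokesRegularity.NavierStokesRegularity.Theorems.AveragedTypeIBlowup.Negative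
open Summit.NavierStokesRegularity.NavierStokesRegularity.Theorems.RungReynoldsOneNegative
open Summit.NavierStokesRegularity.NavierStokesRegularity.Theorems.TypeIConcentration.Negative

/-- Local notation for physical space `ℝ³`. -/
local notation "ℝ³" => EuclideanSpace ℝ (Fin 3)

/-! ## §0 Names for the two halves of the crux -/

/-- **The consequent of the crux**: no Type-I blow-up for finite-energy classical Navier–Stokes
solutions from rapidly decaying data (verbatim the right-hand side of `EulerTypeIGlue`). -/
def NoTypeIClay : Prop :=
  ∀ (ν T : ℝ), 0 < ν → 0 < T → ∀ (u : ℝ → ℝ³ → ℝ³) (p : ℝ → ℝ³ → ℝ),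
    IsClassicalNSSolutionOn (Ico 0 T) ν 0 u p → IsLerayHopfOn T ν 0 (u 0) u →
    HasRapidSpatialDecay (u 0) → IsTypeIBlowup u T → HasSmoothExtensionPast ν 0 u T

/-- **`Thesis` specialised to the Euler datum** (`AveragingDatum.euler`, `B̃ = B`): forward Type-I
exclusion for `H¹⁰_df`-mild Navier–Stokes (`ν = 1`) from Schwartz data — the only instance of
`Thesis` the line `Sketch` uses. -/
def ThesisEuler : Prop :=
  ∀ u₀ : SchwartzMap ℝ³ ℝ³, VectorCalculus.IsDivFree ⇑u₀ → ∀ T : ℝ, 0 < T → ∀ u : ℝ → L2C,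
    AveragingDatum.euler.IsMildSolution (schwartzL2 u₀) (Ico 0 T) u →
    (∃ M : ℝ, ∀ t ∈ Ico 0 T, eLpNorm (u t) ⊤ volume ≤ ENNReal.ofReal (M / Real.sqrt (T - t))) →
    ∃ T' : ℝ, T < T' ∧ ∃ v : ℝ → L2C,
      AveragingDatum.euler.IsMildSolution (schwartzL2 u₀) (Ico 0 T') v ∧ ∀ t ∈ Ico 0 T, v t = u t

/-- The crux is literally `Thesis → NoTypeIClay`. -/
theorem eulerTypeIGlue_iff : EulerTypeIGlue ↔ (Thesis → NoTypeIClay) := Iff.rfl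

/-- `Thesis` contains its Euler-datum instance. -/
theorem thesisEuler_of_thesis (h : Thesis) : ThesisEuler :=
  fun u₀ hdiv T hT u hu hrate =>
    h AveragingDatum.euler euler_isSymmetric euler_hasCancellation u₀ hdiv T hT u hu hrate

/-! ## §1 Logical anatomy: why no kill is available -/

/-- **A refutation of the crux is exactly `Thesis ∧ ¬ NoTypeIClay`.** -/
theorem not_eulerTypeIGlue_iff : ¬ EulerTypeIGlue ↔ (Thesis ∧ ¬ NoTypeIClay) := by
  rw [eulerTypeIGlue_iff, Classical.not_imp]

/-- **If the route's bet is right the crux is vacuously true**: `¬ Thesis → EulerTypeIGlue`. -/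
theorem eulerTypeIGlue_of_not_thesis (h : ¬ Thesis) : EulerTypeIGlue :=
  fun hT => absurd hT h

/-- The same through the route's deciding crux: `AveragedTypeIBlowup` (stmt-1835, `↔ ¬ Thesis`,
landed `averagedTypeIBlowup_iff_not_thesis`) implies the crux. -/
theorem eulerTypeIGlue_of_averagedTypeIBlowup (h : AveragedTypeIBlowup) : EulerTypeIGlue :=
  eulerTypeIGlue_of_not_thesis (averagedTypeIBlowup_iff_not_thesis.mp h)

/-- And if the consequent is a theorem the crux is trivially true. -/
theorem eulerTypeIGlue_of_noTypeIClay (h : NoTypeIClay) : EulerTypeIGlue := fun _ => h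

/-- **A kill of the crux produces a finite-energy Type-I Navier–Stokes singularity from a rapidly
decaying datum** (the `¬ NoTypeIClay` half, unfolded): a negative answer to Clay (A). -/
theorem typeIBlowup_witness_of_not_eulerTypeIGlue (h : ¬ EulerTypeIGlue) :
    ∃ (ν T : ℝ) (u : ℝ → ℝ³ → ℝ³) (p : ℝ → ℝ³ → ℝ), 0 < ν ∧ 0 < T ∧
      IsClassicalNSSolutionOn (Ico 0 T) ν 0 u p ∧ IsLerayHopfOn T ν 0 (u 0) u ∧
      HasRapidSpatialDecay (u 0) ∧ IsTypeIBlowup u T ∧ ¬ HasSmoothExtensionPast ν 0 u T := by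
  obtain ⟨-, hno⟩ := not_eulerTypeIGlue_iff.mp h
  unfold NoTypeIClay at hno
  push Not at hno
  obtain ⟨ν, T, hν, hT, u, p, hcl, hLH, hdec, hTI, hext⟩ := hno
  exact ⟨ν, T, u, p, hν, hT, hcl, hLH, hdec, hTI, hext⟩

/-- **A kill of the crux also proves the route target** (the `Thesis` half) — and with it forward
Type-I exclusion for `H¹⁰_df`-mild Navier–Stokes (`ThesisEuler`). -/
theorem thesisEuler_of_not_eulerTypeIGlue (h : ¬ EulerTypeIGlue) : Thesis ∧ ThesisEuler :=
  ⟨(not_eulerTypeIGlue_iff.mp h).1, thesisEuler_of_thesis (not_eulerTypeIGlue_iff.mp h).1⟩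

/-- **The line proves a stronger statement**: `ThesisEuler → NoTypeIClay` already gives the crux
(the composition `EulerTypeIGlue_of` of `Lines/Sketch.lean` instantiates `Thesis` at
`AveragingDatum.euler` only). -/
theorem eulerTypeIGlue_of_thesisEuler_imp (h : ThesisEuler → NoTypeIClay) : EulerTypeIGlue :=
  fun hT => h (thesisEuler_of_thesis hT)

/-! ## §2 The consequent is neither vacuous nor trivially false; `0 < T` is decoration -/

/-- **Non-vacuity of `NoTypeIClay`**: the rest state `u ≡ 0`, `p ≡ 0` satisfies all four
hypotheses at every viscosity and every `T` (classical, Leray–Hopf from the rapidly decaying datum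
`0`, Type-I with constant `0` — `IsTypeIBlowup` is an upper bound only). -/
theorem noTypeIClay_hypotheses_zero (ν T : ℝ) :
    IsClassicalNSSolutionOn (Ico 0 T) ν 0 (0 : ℝ → ℝ³ → ℝ³) 0 ∧
      IsLerayHopfOn T ν 0 ((0 : ℝ → ℝ³ → ℝ³) 0) 0 ∧
      HasRapidSpatialDecay ((0 : ℝ → ℝ³ → ℝ³) 0) ∧ IsTypeIBlowup (0 : ℝ → ℝ³ → ℝ³) T := by
  refine ⟨isClassicalNSSolutionOn_zero _ _, by simpa using isLerayHopfOn_zero (E := ℝ³) T ν, ?_,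
    ⟨0, Eventually.of_forall fun t x => by simp⟩⟩
  simpa [drift_zero (gI_zero 1)] using drift_rapidDecay (g := gI 1) (gI_zero 1)

/-- … and meets the conclusion there (the rest state on `[0, T+1)` continues itself). -/
theorem noTypeIClay_conclusion_zero (ν T : ℝ) :
    HasSmoothExtensionPast ν 0 (0 : ℝ → ℝ³ → ℝ³) T :=
  ⟨T + 1, lt_add_one T, 0, 0, isClassicalNSSolutionOn_zero _ _, fun _ _ => rfl⟩

/-- **`0 < T` is decoration**: for `T ≤ 0` every field "extends past `T`" (the rest state on
`[0, 1)` agrees with `u` on `Ico 0 T = ∅`). Dropping `0 < T` from `NoTypeIClay` changes nothing. -/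
theorem hasSmoothExtensionPast_of_nonpos (ν : ℝ) (u : ℝ → ℝ³ → ℝ³) {T : ℝ} (hT : T ≤ 0) :
    HasSmoothExtensionPast ν 0 u T :=
  ⟨1, by linarith, 0, 0, isClassicalNSSolutionOn_zero _ _, fun t ht => absurd ht.2 (by linarith [ht.1])⟩

/-- `NoTypeIClay` with `0 < T` deleted is the same statement. -/
theorem noTypeIClay_iff_without_T_pos :
    NoTypeIClay ↔ ∀ (ν T : ℝ), 0 < ν → ∀ (u : ℝ → ℝ³ → ℝ³) (p : ℝ → ℝ³ → ℝ),
      IsClassicalNSSolutionOn (Ico 0 T) ν 0 u p → IsLerayHopfOn T ν 0 (u 0) u →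
      HasRapidSpatialDecay (u 0) → IsTypeIBlowup u T → HasSmoothExtensionPast ν 0 u T := by
  refine ⟨fun h ν T hν u p hcl hLH hdec hTI => ?_, fun h ν T hν _ => h ν T hν⟩
  rcases le_or_gt T 0 with hT | hT
  · exact hasSmoothExtensionPast_of_nonpos ν u hT
  · exact h ν T hν hT u p hcl hLH hdec hTI

/-! ## §3 LOAD-BEARING: the Leray–Hopf (finite-energy) hypothesis cannot be dropped -/

/-- `NoTypeIClay` with the hypothesis `IsLerayHopfOn T ν 0 (u 0) u` deleted. -/
def NoTypeIClayWithoutLerayHopf : Prop :=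
  ∀ (ν T : ℝ), 0 < ν → 0 < T → ∀ (u : ℝ → ℝ³ → ℝ³) (p : ℝ → ℝ³ → ℝ),
    IsClassicalNSSolutionOn (Ico 0 T) ν 0 u p →
    HasRapidSpatialDecay (u 0) → IsTypeIBlowup u T → HasSmoothExtensionPast ν 0 u T

/-- The crux with `IsLerayHopfOn` deleted from its consequent. -/
def EulerTypeIGlueWithoutLerayHopf : Prop :=
  Thesis → NoTypeIClayWithoutLerayHopf

/-- **The Type-I drift is Type-I** (constant `c`): `‖u(t,x)‖ = c((1−t)^{-1/2} − 1) ≤ c/√(1−t)` on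
`[0,1)`. (Witness family `drift (gI c)`, `driftP (gI c)` of the landed
`RungReynoldsOne/Negative/WithoutLerayHopfFalse.lean`.) -/
theorem isTypeIBlowup_driftI {c : ℝ} (hc : 0 ≤ c) : IsTypeIBlowup (drift (gI c)) 1 := by
  refine ⟨c, ?_⟩
  filter_upwards [Ioo_mem_nhdsLT (zero_lt_one' ℝ)] with t ht x
  have hs : 0 < Real.sqrt (1 - t) := Real.sqrt_pos.2 (sub_pos.2 ht.2)
  rw [norm_drift, abs_of_nonneg (gI_nonneg c hc ht.1.le ht.2), le_div_iff₀ hs, mul_comm,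
    sqrt_mul_gI c ht.2]
  nlinarith [Real.sqrt_nonneg (1 - t)]

/-- **Finite energy is load-bearing.** `NoTypeIClay` with `IsLerayHopfOn` dropped is FALSE: the
drift `u = ((1−t)^{-1/2} − 1)e₀`, `p = −½(1−t)^{-3/2}x₀` (`ν = T = 1`) is classical on
`[0,1) × ℝ³`, starts from the Schwartz datum `0`, is Type-I with constant `1`, and does not extend
(Koch–Nadirashvili–Seregin–Šverák 2009, §1 p. 3: parasitic solutions `u = b(t)`, `p = −b′(t)·x`).
[cite: KochNadirashviliSereginSverak2009, §1 p. 3] -/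
theorem noTypeIClay_false_without_lerayHopf : ¬ NoTypeIClayWithoutLerayHopf := fun h =>
  drift_not_hasSmoothExtensionPast (tendsto_abs_gI_atTop 1 one_pos) 1
    (h 1 1 one_pos one_pos (drift (gI 1)) (driftP (gI 1)) (drift_isClassical (gI_contDiffOn 1) 1)
      (drift_rapidDecay (gI_zero 1)) (isTypeIBlowup_driftI zero_le_one))

/-- The one clause the witness violates is finite energy: it is not Leray–Hopf (its slices for
`t > 0` are non-zero constant fields, not in `L²`; landed `not_isLerayHopfOn_driftI`). -/
theorem driftI_not_lerayHopf (ν : ℝ) : ¬ IsLerayHopfOn 1 ν 0 (drift (gI 1) 0) (drift (gI 1)) :=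
  not_isLerayHopfOn_driftI one_pos ν

/-- **Exactly one clause of `NoTypeIClay` fails on the witness.** At `ν = T = 1` the Type-I drift
meets every hypothesis of the consequent except `IsLerayHopfOn`, and violates the conclusion:
classical, rapidly decaying datum, Type-I, NOT Leray–Hopf, NO smooth extension. So the finite-energy
clause is not merely used by the line — it is the unique separator between the crux's consequent and
a false statement. -/
theorem driftI_all_but_lerayHopf (ν : ℝ) :
    IsClassicalNSSolutionOn (Ico 0 1) ν 0 (drift (gI 1)) (driftP (gI 1)) ∧
      HasRapidSpatialDecay (drift (gI 1) 0) ∧ IsTypeIBlowup (drift (gI 1)) 1 ∧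
      ¬ IsLerayHopfOn 1 ν 0 (drift (gI 1) 0) (drift (gI 1)) ∧
      ¬ HasSmoothExtensionPast ν 0 (drift (gI 1)) 1 :=
  ⟨drift_isClassical (gI_contDiffOn 1) ν, drift_rapidDecay (gI_zero 1), isTypeIBlowup_driftI zero_le_one,
    not_isLerayHopfOn_driftI one_pos ν,
    drift_not_hasSmoothExtensionPast (tendsto_abs_gI_atTop 1 one_pos) ν⟩

/-- **Hence the glue without Leray–Hopf is exactly the negation of the route target.** -/
theorem eulerTypeIGlueWithoutLerayHopf_iff_not_thesis : EulerTypeIGlueWithoutLerayHopf ↔ ¬ Thesis :=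
  ⟨fun h hT => noTypeIClay_false_without_lerayHopf (h hT), fun h hT => absurd hT h⟩

/-- … equivalently, it IS the deciding crux `AveragedTypeIBlowup`. -/
theorem eulerTypeIGlueWithoutLerayHopf_iff_averagedTypeIBlowup :
    EulerTypeIGlueWithoutLerayHopf ↔ AveragedTypeIBlowup :=
  eulerTypeIGlueWithoutLerayHopf_iff_not_thesis.trans averagedTypeIBlowup_iff_not_thesis.symm

/-! ## §4 The other hypotheses: what dropping them yields (no `_false_without_` theorem exists) -/

/-- Dropping `IsTypeIBlowup` turns the consequent into plain "no blow-up", the hypothesis of the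
route's proved support `NoBlowupToClay` — i.e. Clay (A) minus local theory; conversely that
statement trivially gives `NoTypeIClay`. Neither direction is refutable here. -/
theorem noTypeIClay_of_noBlowup
    (h : ∀ (ν T : ℝ), 0 < ν → 0 < T → ∀ (u : ℝ → ℝ³ → ℝ³) (p : ℝ → ℝ³ → ℝ),
      IsClassicalNSSolutionOn (Ico 0 T) ν 0 u p → IsLerayHopfOn T ν 0 (u 0) u →
      HasRapidSpatialDecay (u 0) → HasSmoothExtensionPast ν 0 u T) : NoTypeIClay :=
  fun ν T hν hT u p hcl hLH hdec _ => h ν T hν hT u p hcl hLH hdec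

/-- With the route's shared crux `NoTypeII` (stmt-0056) the consequent IS "no blow-up": this is the
logic of the route's `closes` (`NoTypeIClay ∧ NoTypeII ⇒ NoBlowup`). -/
theorem noBlowup_of_noTypeIClay_of_noTypeII (h₁ : NoTypeIClay) (h₂ : NoTypeII) :
    ∀ (ν T : ℝ), 0 < ν → 0 < T → ∀ (u : ℝ → ℝ³ → ℝ³) (p : ℝ → ℝ³ → ℝ),
      IsClassicalNSSolutionOn (Ico 0 T) ν 0 u p → IsLerayHopfOn T ν 0 (u 0) u →
      HasRapidSpatialDecay (u 0) → HasSmoothExtensionPast ν 0 u T := by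
  intro ν T hν hT u p hcl hLH hdec
  by_contra hext
  exact hext (h₁ ν T hν hT u p hcl hLH hdec (h₂ ν T hν hT u p ⟨hcl, hext⟩ hLH hdec))

/-! ## §5 Line `Sketch`: the one junk regime inside a stub signature (`ν ≤ 0` in `stub_testToH10`) -/

/-- For `τ ≤ 0` the tree's heat propagator is the identity (its symbol is frozen at `τ = 0`), so
in `stub_testToH10` (no sign hypothesis on `ν`) the case `ν ≤ 0` reads
`⟨U t, w⟩ = ⟨U 0, w⟩ + ∫₀ᵗ ⟨B(U s, U s), w⟩ ds` on both sides — the density passage is unaffected. -/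
theorem heat_of_nonpos {τ : ℝ} (hτ : τ ≤ 0) (u : L2C) : heat τ u = u := by
  have h : (memLp_top_heatSymbol τ).toLp (heatSymbol τ) =
      (memLp_top_heatSymbol 0).toLp (heatSymbol 0) := by
    refine MemLp.toLp_congr _ _ (Eventually.of_forall fun ξ => ?_)
    simp [heatSymbol, max_eq_right hτ]
  rw [heat, h, ← heat, heat_zero]

end Summit.NavierStokesRegularity.NavierStokesRegularity.Cruxes.EulerTypeIGlue.Disproof

end
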